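import Summits.SmoothPoincare4.SmoothPoincare4.Cruxes.NoncompactShrinkerGap.SketchK1

/-! Triage scratch (refuter cruxtri r1-3): how much logical content do the two ideator-1
skeletons carry?  -/

open scoped ENNReal
open Summit.SmoothPoincare4.SmoothPoincare4.Cruxes.NoncompactShrinkerGap.SketchK1

namespace Summit.SmoothPoincare4.SmoothPoincare4.Cruxes.NoncompactShrinkerGap.TriageR1K3

/-- decay-or-expand: with the abstract predicate instantiated as `Stable D := D.Z ≤ cylBound`,
`StableGap` is a tautology … -/
example : StableGap (fun D ↦ D.Z ≤ cylBound) := fun _ h ↦ h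

/-- … and `DecayTerminus` is literally "the crux for maximisers". -/
example : DecayTerminus (fun D ↦ D.Z ≤ cylBound) ↔ (∀ D : Datum, D.IsMaximiser → D.Z ≤ cylBound) := by
  constructor
  · intro h D hmax
    by_cases hlt : cylBound < D.Z
    · exact h D hmax hlt
    · exact le_of_not_gt hlt
  · intro h D hmax _
    exact h D hmax

/-- Conversely the crux gives `DecayTerminus S` … no: it gives the hypothesis-free bound, from which
`DecayTerminus S` follows for EVERY `S` vacuously (the guard `cylBound < D.Z` is then false). -/
example (S : Datum → Prop) (h : Gap) : DecayTerminus S := fun D _ hlt ↦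
  absurd (h D) (not_le.mpr hlt)

/-- So, given `MaximiserExists`, the skeleton `crux_of_decay S` is equivalent to the crux for every
choice of `S`: the typed reduction's only non-trivial content is (E) `MaximiserExists`; the
mathematics of (D) lives entirely in the (untyped) meaning of `Stable`. -/
example (hE : MaximiserExists) :
    Gap ↔ ∃ S : Datum → Prop, DecayTerminus S ∧ StableGap S := by
  constructor
  · intro h
    exact ⟨fun D ↦ D.Z ≤ cylBound, fun D _ hlt ↦ absurd (h D) (not_le.mpr hlt), fun _ hD ↦ hD⟩
  · rintro ⟨S, hT, hS⟩
    exact crux_imp_gap (crux_of_decay S hE hT hS)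

/-- cylindrical-blowdown: the exhaustion is an honest case split — each stub is the crux restricted
to a sub-class (so crux ⇒ each stub; jointly they ⇒ crux by `crux_of_exhaustion`). -/
example (h : Gap) : UnboundedScalarGap ∧ NonDecayingScalarGap ∧ ScalarFlatGap :=
  ⟨fun D _ ↦ h D, fun D _ _ ↦ h D, fun D _ ↦ h D⟩

end Summit.SmoothPoincare4.SmoothPoincare4.Cruxes.NoncompactShrinkerGap.TriageR1K3
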